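import Summits.QuantumFields.YangMills.Theses.ThermalDescent

/-!
# BC3 birth skeleton — crux `HypercubeSeam` (stmt-QuantumFields-26515) of route `ThermalDescent` (rev 2)

Ideator ym-idea-6 g3, 2026-08-28.  Two registered stubs and the kernel-checked composition
`HypercubeSeam_of : HypercubeSeam` (uses exactly `stub_transport`, `stub_rpcs`; sorries ONLY inside `stub_*`).
Write `P = 2L+1`, `⟨F, F'⟩_θ := Cov_P(F ∘ refl, F')` (the items' `Cov`/`refl` on the hypercubic `Fin`-torus `P⁴`,
time = last `Fin` coordinate, reflection in the site plane `t = 0` and the link plane `t = L + ½`), `B = B_v` the slab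
observable, `D = D_v` the electric discrepancy, `Qrp = ⟨B,B⟩_θ`, `Drp = ⟨D,D⟩_θ`.

* `stub_transport` (M–L, bookkeeping, load-bearing for the literal match with NT) — DICTIONARY + EXACT REFLECTION OF THE
  CORNER DENSITY: `Q2 G r β L s (θv) v = ⟨B,B⟩_θ + ⟨D,B⟩_θ`.  Content: (a) the torus dictionary `box 4 L` / `torusLift
  (2L+1)` / `wilsonMeasure` / `dens = actionDensity ∘ configShift` (time = coordinate 0) ≅ `FinTorusSite P P P P` with the
  weighted product Haar measure `w/Z` and `posE` (centred coordinates `cc`, time first) — same action `Σ_p (N − Re tr ρ U_p)`,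
  so `Q2(f,g) = Cov_P(B_f, B_g)` by bilinearity; (b) under `refl` magnetic plaquettes at time `t` go to time `−t` and
  electric ones to electric ones based at `−t−1` (inverse of a cyclic conjugate: same `Re tr` for unitary `r`), whence
  `B_v ∘ refl = B_{θv} + D_{θv}` and `D_v ∘ refl = −D_{θv}` — the wrap-around terms at `cc t = L` vanish because
  `tsupport v ⊆ {δ₁ < y₀ < δ₂}` with `δ₂ + s ≤ s·L` — so `B_{θv} = (B_v + D_v) ∘ refl`.
* `stub_rpcs` (M, reflection positivity on the ODD torus) — `0 ≤ ⟨B + D, B + D⟩_θ = Qrp + 2⟨D,B⟩_θ + Drp`: `B_v + D_v` is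
  measurable w.r.t. links with all endpoints in times `[0, L]` (plaquette base times `1 … L−1`), the torus state is
  `refl`-invariant (symmetry `⟨D,B⟩_θ = ⟨B,D⟩_θ`, bilinearity), and `⟨F,F⟩_θ = Z⁻¹·‖𝕋^(m/2) 𝔽̂ 𝕋^(n/2)‖²_HS ≥ 0` with
  `𝕋 ≥ 0` for `β ≥ 0` (Osterwalder–Seiler: `exp(β Re tr ρ)` is of positive type; one site plane, one link plane).

Composition: `2·Q2 = 2Qrp + 2⟨D,B⟩_θ ≥ 2Qrp − (Qrp + Drp) = Qrp − Drp` — linear arithmetic.  Per-stub probes: neither stub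
is the crux (an identity, resp. a positivity statement) nor NT.
-/

set_option autoImplicit false
set_option maxHeartbeats 800000
set_option linter.unusedVariables false

namespace Summit.QuantumFields.YangMills.Cruxes.HypercubeSeam.Birth

open MeasureTheory

/-- **stub_transport** (M–L): torus dictionary + exact reflection of the corner density: `Q2(θv,v) = ⟨B,B⟩_θ + ⟨D,B⟩_θ`. -/
theorem stub_transport :
    ∀ (G : Type) [Group G] [TopologicalSpace G] [IsTopologicalGroup G] [CompactSpace G], Literature.MathematicalPhysics.QuantumFieldTheory.IsCompactSimpleLieGroup G → letI : MeasurableSpace G := borel G; haveI : BorelSpace G := ⟨rfl⟩; ∀ (r : Literature.MathematicalPhysics.QuantumFieldTheory.LatticeRep G), let St : ℕ → ℕ → Type := fun S T => Literature.MathematicalPhysics.QuantumFieldTheory.FinTorusSite S S S T; let Cfg : ℕ → ℕ → Type := fun S T => Literature.MathematicalPhysics.QuantumFieldTheory.FinTorusSite S S S T × Fin 4 → G; let cc : (n : ℕ) → Fin n → ℤ := fun n i => if 2 * i.val < n then (i.val : ℤ) else (i.val : ℤ) - n; let posE : (S T : ℕ) → St S T → EuclideanSpace ℝ (Fin 4)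 := fun S T x => Literature.MathematicalPhysics.QuantumLattice.siteToE (d := 4) ![cc T x.2.2.2, cc S x.1, cc S x.2.1, cc S x.2.2.1]; let P : (S T : ℕ) → St S T → Fin 4 → Fin 4 → Cfg S T → ℝ := fun _ _ x i j U => (r.ρ (Literature.MathematicalPhysics.QuantumFieldTheory.finTorusPlaquette U x i j)).trace.re; let A : (S T : ℕ) → St S T → Cfg S T → ℝ := fun S T x U => ∑ q : {q : Fin 4 × Fin 4 // q.1 < q.2}, P S T x q.1.1 q.1.2 U; let Ael : (S T : ℕ) → St S T → Cfg S T → ℝ := fun S T x U => ∑ i : Fin 3, P S T x (Fin.castSucc i) (Fin.last 3) U; let w : ℝ → (S T : ℕ) → Cfg S T → ℝ := fun β S T U => Real.exp (-β * ∑ x : St S T, ∑ q : {q : Fin 4 × Fin 4 // q.1 < q.2}, ((r.N : ℝ) - P S T x q.1.1 q.1.2 U)); let E : ℝ → (S T : ℕ) → (Cfg S T → ℝ) → ℝ := fun β S T F => (∫ U : Literature.MathematicalPhysics.QuantumFieldTheory.FinTorusSite S S S T × Fin 4 → G, F U * w β S T U ∂MeasureTheory.Measure.pi (fun _ => Literature.MathematicalPhysics.QuantumFieldTheory.haarProbability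 G)) / Literature.MathematicalPhysics.QuantumFieldTheory.wilsonFinTorusPartition r.ρ β S S S T; let Cov : ℝ → (S T : ℕ) → (Cfg S T → ℝ) → (Cfg S T → ℝ) → ℝ := fun β S T F F' => E β S T (fun U => F U * F' U) - E β S T F * E β S T F'; let refl : (S T : ℕ) → Cfg S T → Cfg S T := fun _ T U e => if e.2 = Fin.last 3 then (U ((e.1.1, e.1.2.1, e.1.2.2.1, Fin.rev e.1.2.2.2), Fin.last 3))⁻¹ else U ((e.1.1, e.1.2.1, e.1.2.2.1, ⟨(T - e.1.2.2.2.val) % T, Nat.mod_lt _ e.1.2.2.2.pos⟩), e.2); let B : (S T : ℕ) → ℝ → SchwartzMap (EuclideanSpace ℝ (Fin 4)) ℝ → Cfg S T → ℝ := fun S T s f U => ∑ x : St S T, f (s • posE S T x) * A S T x U; let Qrp : ℝ → (S T : ℕ) → ℝ → SchwartzMap (EuclideanSpace ℝ (Fin 4)) ℝ → ℝ := fun β S T s f => Cov β S T (fun U => B S T s f (refl S T U)) (B S T s f); let D : (S T : ℕ) → ℝ → SchwartzMap (EuclideanSpace ℝ (Fin 4)) ℝ → Cfg S T → ℝ :=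 fun S T s f U => ∑ x : St S T, (f (s • posE S T x + s • EuclideanSpace.single (0 : Fin 4) (1 : ℝ)) - f (s • posE S T x)) * Ael S T x U; let Drp : ℝ → (S T : ℕ) → ℝ → SchwartzMap (EuclideanSpace ℝ (Fin 4)) ℝ → ℝ := fun β S T s f => Cov β S T (fun U => D S T s f (refl S T U)) (D S T s f); ∀ (β : ℝ) (L : ℕ) (s : ℝ) (v : SchwartzMap (EuclideanSpace ℝ (Fin 4)) ℝ) (δ₁ δ₂ : ℝ), 0 ≤ β → 1 ≤ L → 0 < s → 0 < δ₁ → tsupport v ⊆ {y : EuclideanSpace ℝ (Fin 4) | δ₁ < y 0 ∧ y 0 < δ₂} → δ₂ + s ≤ s * L → Summit.QuantumFields.YangMills.Cruxes.OSLegsFromFemtoAndGap.DlrCollarTransfer.Q2 G r β L s (Literature.MathematicalPhysics.QuantumLattice.thetaTest 4 v) v = Qrp β (2 * L + 1) (2 * L + 1) s v + Cov β (2 * L + 1) (2 * L + 1) (fun U => D (2 * L + 1) (2 * L + 1) s v (refl (2 * L + 1) (2 * L + 1) U)) (B (2 * L + 1) (2 * L + 1) s v) := by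
  sorry

/-- **stub_rpcs** (M): reflection positivity of `B_v + D_v` on the odd torus at `β ≥ 0`, expanded by bilinearity and symmetry. -/
theorem stub_rpcs :
    ∀ (G : Type) [Group G] [TopologicalSpace G] [IsTopologicalGroup G] [CompactSpace G], Literature.MathematicalPhysics.QuantumFieldTheory.IsCompactSimpleLieGroup G → letI : MeasurableSpace G := borel G; haveI : BorelSpace G := ⟨rfl⟩; ∀ (r : Literature.MathematicalPhysics.QuantumFieldTheory.LatticeRep G), let St : ℕ → ℕ → Type := fun S T => Literature.MathematicalPhysics.QuantumFieldTheory.FinTorusSite S S S T; let Cfg : ℕ → ℕ → Type := fun S T => Literature.MathematicalPhysics.QuantumFieldTheory.FinTorusSite S S S T × Fin 4 → G; let cc : (n : ℕ) → Fin n → ℤ := fun n i => if 2 * i.val < n then (i.val : ℤ) else (i.val : ℤ) - n; let posE : (S T : ℕ) → St S T → EuclideanSpace ℝ (Fin 4) := fun S T x => Literature.MathematicalPhysics.QuantumLattice.siteToE (d := 4) ![cc T x.2.2.2, cc S x.1, cc S x.2.1, cc S x.2.2.1]; let P : (S T : ℕ) → St S T → Fin 4 → Fin 4 → Cfg S T →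 ℝ := fun _ _ x i j U => (r.ρ (Literature.MathematicalPhysics.QuantumFieldTheory.finTorusPlaquette U x i j)).trace.re; let A : (S T : ℕ) → St S T → Cfg S T → ℝ := fun S T x U => ∑ q : {q : Fin 4 × Fin 4 // q.1 < q.2}, P S T x q.1.1 q.1.2 U; let Ael : (S T : ℕ) → St S T → Cfg S T → ℝ := fun S T x U => ∑ i : Fin 3, P S T x (Fin.castSucc i) (Fin.last 3) U; let w : ℝ → (S T : ℕ) → Cfg S T → ℝ := fun β S T U => Real.exp (-β * ∑ x : St S T, ∑ q : {q : Fin 4 × Fin 4 // q.1 < q.2}, ((r.N : ℝ) - P S T x q.1.1 q.1.2 U)); let E : ℝ → (S T : ℕ) → (Cfg S T → ℝ) → ℝ := fun β S T F => (∫ U : Literature.MathematicalPhysics.QuantumFieldTheory.FinTorusSite S S S T × Fin 4 → G, F U * w β S T U ∂MeasureTheory.Measure.pi (fun _ => Literature.MathematicalPhysics.QuantumFieldTheory.haarProbability G)) / Literature.MathematicalPhysics.QuantumFieldTheory.wilsonFinTorusPartition r.ρ β S S S T; let Cov : ℝ → (S T : ℕ) → (Cfg S T → ℝ) → (Cfg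 S T → ℝ) → ℝ := fun β S T F F' => E β S T (fun U => F U * F' U) - E β S T F * E β S T F'; let refl : (S T : ℕ) → Cfg S T → Cfg S T := fun _ T U e => if e.2 = Fin.last 3 then (U ((e.1.1, e.1.2.1, e.1.2.2.1, Fin.rev e.1.2.2.2), Fin.last 3))⁻¹ else U ((e.1.1, e.1.2.1, e.1.2.2.1, ⟨(T - e.1.2.2.2.val) % T, Nat.mod_lt _ e.1.2.2.2.pos⟩), e.2); let B : (S T : ℕ) → ℝ → SchwartzMap (EuclideanSpace ℝ (Fin 4)) ℝ → Cfg S T → ℝ := fun S T s f U => ∑ x : St S T, f (s • posE S T x) * A S T x U; let Qrp : ℝ → (S T : ℕ) → ℝ → SchwartzMap (EuclideanSpace ℝ (Fin 4)) ℝ → ℝ := fun β S T s f => Cov β S T (fun U => B S T s f (refl S T U)) (B S T s f); let D : (S T : ℕ) → ℝ → SchwartzMap (EuclideanSpace ℝ (Fin 4)) ℝ → Cfg S T → ℝ := fun S T s f U => ∑ x : St S T, (f (s • posE S T x + s • EuclideanSpace.single (0 : Fin 4) (1 : ℝ)) - f (s • posE S T x)) * Ael S T x U; let Drp : ℝ →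 (S T : ℕ) → ℝ → SchwartzMap (EuclideanSpace ℝ (Fin 4)) ℝ → ℝ := fun β S T s f => Cov β S T (fun U => D S T s f (refl S T U)) (D S T s f); ∀ (β : ℝ) (L : ℕ) (s : ℝ) (v : SchwartzMap (EuclideanSpace ℝ (Fin 4)) ℝ) (δ₁ δ₂ : ℝ), 0 ≤ β → 1 ≤ L → 0 < s → 0 < δ₁ → tsupport v ⊆ {y : EuclideanSpace ℝ (Fin 4) | δ₁ < y 0 ∧ y 0 < δ₂} → δ₂ + s ≤ s * L → 0 ≤ Qrp β (2 * L + 1) (2 * L + 1) s v + 2 * Cov β (2 * L + 1) (2 * L + 1) (fun U => D (2 * L + 1) (2 * L + 1) s v (refl (2 * L + 1) (2 * L + 1) U)) (B (2 * L + 1) (2 * L + 1) s v) + Drp β (2 * L + 1) (2 * L + 1) s v := by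
  sorry

/-- **Composition** (kernel-checked, no sorry): `HypercubeSeam` from the two stubs by linear arithmetic. -/
theorem HypercubeSeam_of :
    Summit.QuantumFields.YangMills.Theses.ThermalDescent.HypercubeSeam := by
  intro G _ _ _ _ hG r
  dsimp only
  intro β L s v δ₁ δ₂ hβ hL hs hδ₁ hsupp hsz
  have h1 := stub_transport G hG r β L s v δ₁ δ₂ hβ hL hs hδ₁ hsupp hsz
  have h2 := stub_rpcs G hG r β L s v δ₁ δ₂ hβ hL hs hδ₁ hsupp hsz
  dsimp only at h1 h2
  linarith

end Summit.QuantumFields.YangMills.Cruxes.HypercubeSeam.Birth
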